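import Summits.AtomisticToContinuum.Crystallization.Theses.ChessboardParticlePlanes
import Summits.AtomisticToContinuum.Crystallization.Theorems.ChessboardParticlePlanesLjBilayerHcpNormalForm
import Summits.AtomisticToContinuum.Crystallization.Theorems.PricedLinkCensusStackingHingeHcpEnergyMinOnBox
import Summits.AtomisticToContinuum.Crystallization.Theorems.ChessboardParticlePlanesLjBilayerHcpStubHcpPowerSums
import Summits.AtomisticToContinuum.Crystallization.Theorems.ChessboardParticlePlanesLjBilayerHcpStubPowerSumsAntitone
import Summits.AtomisticToContinuum.Crystallization.Theorems.ChessboardParticlePlanesLjBilayerHcpStubPowerSumTail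
import Summits.AtomisticToContinuum.Crystallization.Theorems.ChessboardParticlePlanesLjBilayerHcpNumericReduction

/-!
# Line `Sketch` for crux `ChessboardParticlePlanes.LjBilayerHcp` (item stmt-AtomisticToContinuum-6710)
# — LEAD SKELETON v3 (registered form), cycle 4 (seat c3): structural core Sσ + the certificate stub N4

Crux (by name, concluded by `LjBilayerHcp_of` below):
`Summit.AtomisticToContinuum.Crystallization.Theses.ChessboardParticlePlanes.LjBilayerHcp` —
some relaxed hcp `hcpPeriodicConfiguration a h` with `(a, h)` in the box `[47/50, 1] × [39a/50, 17a/20]`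
has Lennard-Jones energy per particle `≤` that of every `2/3`-separated PERIOD-2 STACK `B`
(points on the planes `x₂ ∈ t + cℤ`, `c ≥ 3/4`, point set invariant under `± 2c e₃`).

History.  Cycles 1–2 (seats 0, c1) landed S1 `stub_presentation` (p102865), S2 `stub_normalForm` (p104663),
S3 `stub_energyIdentity` (p106374), the transfer `ljBilayerHcp_of_oneLayer` (p116017) and
`ljBilayerHcp_iff_normalForm` (p117119).  Cycle 3 (seat c2) split the core into Sσ + Sν and LANDED the numeric face:
N1 `stub_hcpPowerSums` (p129719), N2 `stub_powerSums_antitone` (p129717), N5 `stub_powerSum_tail` (p130234),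
Aux (p129787), Sums (p130067), glue `numeric_of_certificate` (p130319), CertBridge (p130652), CertClauses (p130836),
N4 `stub_certificate` (p131061, `--computational`: 61 `native_decide` leaves), `stub_numeric` (p131218) and the transfer
`ljBilayerHcp_of_structural : Sσ → LjBilayerHcp` (p131363).

Cycle 4 (this seat).  The one-stub skeleton `LjBilayerHcp_of := ljBilayerHcp_of_structural stub_structural`
(work/LjBilayerHcp.lean, rc 0, 1 sorry, audit: proves the crux by name) is the TRUE state modulo the gate's
`--computational` acceptance of N4; but its axiom closure contains the `native_decide` axioms of p131061
(`…cert_cover_k._native.native_decide.ax_*`), which `ledger skeleton check` rejects (`skeleton.axiom`, whitelist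
{propext, Classical.choice, Quot.sound}).  The REGISTERED skeleton therefore keeps N4 as an explicit stub (its
computational proof is p131061; a kernel-whitelist proof = the same 61 floor-sum inequalities by `decide`/`norm_num`
evaluation, or a `--computational` closure of the crux, is bookkeeping debt, not mathematics) next to the one real
open stub:

  Sσ `stub_structural` (THE CORE, open problem) every `2/3`-separated normal period-2 stack with spacing `c ≥ 3/4` is
                        beaten by SOME hcp of the class (`a ≥ 2/3`, `h ≥ 3/4`) — witness-free, box-free; the
                        two-species planar Lennard-Jones crystallization content of the crux;
  N4 `stub_certificate` (COMPUTATIONAL, landed as p131061 with `native_decide`; kept as a stub only for the axiom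
                        whitelist of the skeleton checker) finitely many inequalities between box partial sums.

`LjBilayerHcp_of` = argmin on the box ∘ Sν(N1, N2, N5, glue, N4) ∘ Sσ ∘ `ljBilayerHcp_of_normalForm`.
Sorries live only in `stub_*`.
-/

noncomputable section

open scoped BigOperators Classical
open Literature.MathematicalPhysics.StatisticalMechanics

namespace Summit.AtomisticToContinuum.Crystallization.Cruxes.LjBilayerHcp.Sketch

local notation "E3" => EuclideanSpace ℝ (Fin 3)

/-! ## Registered stubs (the only sorries of the file) -/

/-- Sσ — THE STRUCTURAL CORE (crux-sized; the open two-species planar crystallization content, witness-free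
and box-free).  For every spacing `c ≥ 3/4` and every `2/3`-separated NORMAL period-2 stack `B` (`2c e₃` is a
period, all periods have heights in `2cℤ`, all points have heights in `cℤ`) there is an hcp OF THE CLASS
(`a ≥ 2/3`, `h ≥ 3/4`) with energy per particle `≤ e(B)`.  Intended mechanism: any proof must show that the best
period-2 restack of `B`'s own layers at spacing `c` loses to two triangular layers of a common spacing in hollow
registry (then `h = c`). -/
theorem stub_structural :
    ∀ c : ℝ, 3 / 4 ≤ c → ∀ B : PeriodicConfiguration 3,
      (∀ x ∈ B.points, ∀ y ∈ B.points, x ≠ y → (2 : ℝ) / 3 ≤ dist x y) →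
      (2 * c) • EuclideanSpace.single (2 : Fin 3) (1 : ℝ) ∈ B.lattice →
      (∀ g ∈ B.lattice, ∃ k : ℤ, g 2 = 2 * c * (k : ℝ)) →
      (∀ x ∈ B.points, ∃ k : ℤ, x 2 = c * (k : ℝ)) →
      ∃ a h : ℝ, ∃ (ha : a ≠ 0) (hh : h ≠ 0), 2 / 3 ≤ a ∧ 3 / 4 ≤ h ∧
        (hcpPeriodicConfiguration ha hh).energyPerParticle lennardJones ≤
          B.energyPerParticle lennardJones := by
  sorry

/-- N4 — THE CERTIFICATE (computational).  With the planar form `Q`, the box partial sums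
`B n x = ∑_{|k|,|i|,|j| ≤ 12} [v ≠ 0](Q v + k²x²)⁻ⁿ` and the tail bound `T` of `stub_powerSum_tail` at `K = N = 12`:
(U) `(1/24)(a₀²)⁻⁶(B₆(49/60) + ρ(49/60)⁻³T(49/60)) − (1/12)(a₀²)⁻³B₃(49/60) ≤ −179/250`, `a₀ = 97/100`;
(S) `(1/12)((3/2)²)⁻³(B₃(1/2) + T(1/2)) ≤ 179/250`; (L) `(B₃(11/10) + T(11/10))² ≤ 24·(in-plane box sum of ⁻⁶)·(179/250)`;
and every `t ∈ [1/2, 11/10]` lies in a rational interval `[l, r]`, `l > 0`, with either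
(B) `(B₃ l + T l)² ≤ 24 B₆ r · 179/250` or (A) `[l, r] ⊆ [39/50, 17/20]`, `(47/50)⁶(B₃ l + T l) ≤ B₆ r`,
`B₆ l + ρ(l)⁻³ T l ≤ B₃ r` (`ρ(x) = min 1 (min (1/3 + x²) (4x²))`).  Verified in exact arithmetic with 58 intervals
(denominator `2⁶⁰`); Lean discharge = box-sum floor/ceil evaluator + `native_decide`. -/
theorem stub_certificate :
    ∀ (Q : ℤ × ℤ × ℤ → ℝ),
    (Q = fun v => (v.2.1 : ℝ) ^ 2 + (v.2.1 : ℝ) * v.2.2 + (v.2.2 : ℝ) ^ 2 +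
      (if Even v.1 then 0 else ((v.2.1 : ℝ) + v.2.2 + 1 / 3))) →
    ∀ (B : ℕ → ℝ → ℝ),
    (B = fun n x => ∑ v ∈ Finset.Icc (-12 : ℤ) 12 ×ˢ (Finset.Icc (-12 : ℤ) 12 ×ˢ Finset.Icc (-12 : ℤ) 12),
      if v = 0 then (0 : ℝ) else ((Q v + (v.1 : ℝ) ^ 2 * x ^ 2)⁻¹) ^ n) →
    ∀ (T : ℝ → ℝ),
    (T = fun x => (∑ k ∈ Finset.Icc (-((12 : ℕ) : ℤ)) ((12 : ℕ) : ℤ),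
        (4608 : ℝ) / (5 * ((3 * ((12 : ℕ) : ℝ) - 2) ^ 2 + 12 * (k : ℝ) ^ 2 * x ^ 2) ^ 2)) +
        64 / (15 * ((12 : ℕ) : ℝ) ^ 3 * x ^ 4) + 18 / (5 * ((12 : ℕ) : ℝ) ^ 5 * x ^ 6)) →
      ((1 / 24) * (((97 / 100 : ℝ) ^ 2)⁻¹) ^ 6 *
          (B 6 (49 / 60) + ((min 1 (min (1 / 3 + (49 / 60 : ℝ) ^ 2) (4 * (49 / 60 : ℝ) ^ 2)))⁻¹) ^ 3 * T (49 / 60)) -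
        (1 / 12) * (((97 / 100 : ℝ) ^ 2)⁻¹) ^ 3 * B 3 (49 / 60) ≤ -179 / 250) ∧
      ((1 / 12) * (((3 / 2 : ℝ) ^ 2)⁻¹) ^ 3 * (B 3 (1 / 2) + T (1 / 2)) ≤ 179 / 250) ∧
      ((B 3 (11 / 10) + T (11 / 10)) ^ 2 ≤
        24 * (∑ p ∈ Finset.Icc (-12 : ℤ) 12 ×ˢ Finset.Icc (-12 : ℤ) 12,
          if p = 0 then (0 : ℝ) else (((p.1 : ℝ) ^ 2 + (p.1 : ℝ) * p.2 + (p.2 : ℝ) ^ 2)⁻¹) ^ 6) * (179 / 250)) ∧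
      (∀ t : ℝ, 1 / 2 ≤ t → t ≤ 11 / 10 → ∃ l r : ℚ, (l : ℝ) ≤ t ∧ t ≤ (r : ℝ) ∧ 0 < l ∧
        ((B 3 (l : ℝ) + T (l : ℝ)) ^ 2 ≤ 24 * B 6 (r : ℝ) * (179 / 250) ∨
         ((39 / 50 : ℚ) ≤ l ∧ r ≤ (17 / 20 : ℚ) ∧
          (47 / 50 : ℝ) ^ 6 * (B 3 (l : ℝ) + T (l : ℝ)) ≤ B 6 (r : ℝ) ∧
          B 6 (l : ℝ) + ((min 1 (min (1 / 3 + (l : ℝ) ^ 2) (4 * (l : ℝ) ^ 2)))⁻¹) ^ 3 * T (l : ℝ) ≤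
            B 3 (r : ℝ)))) := by
  sorry

/-! ## Pure logic of the line -/

/-- **Sν, the numeric face, DERIVED**: every `hcp(a, h)` with `a ≥ 2/3`, `h ≥ 3/4` is beaten by some hcp of the
box — from the landed N1 (p129719), N2 (p129717), N5 (p130234), the landed glue `numeric_of_certificate` and the
certificate stub N4.  No sorry of its own. -/
theorem numeric_holds :
    ∀ a h : ℝ, ∀ (ha : a ≠ 0) (hh : h ≠ 0), 2 / 3 ≤ a → 3 / 4 ≤ h →
      ∃ a' h' : ℝ, ∃ (ha' : a' ≠ 0) (hh' : h' ≠ 0),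
        47 / 50 ≤ a' ∧ a' ≤ 1 ∧ 39 / 50 * a' ≤ h' ∧ h' ≤ 17 / 20 * a' ∧
        (hcpPeriodicConfiguration ha' hh').energyPerParticle lennardJones ≤
          (hcpPeriodicConfiguration ha hh).energyPerParticle lennardJones := by
  -- the three abbreviations, spelled once
  let Q : ℤ × ℤ × ℤ → ℝ := fun v => (v.2.1 : ℝ) ^ 2 + (v.2.1 : ℝ) * v.2.2 + (v.2.2 : ℝ) ^ 2 +
      (if Even v.1 then 0 else ((v.2.1 : ℝ) + v.2.2 + 1 / 3))
  let Bx : ℕ → ℝ → ℝ := fun n x =>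
    ∑ v ∈ Finset.Icc (-12 : ℤ) 12 ×ˢ (Finset.Icc (-12 : ℤ) 12 ×ˢ Finset.Icc (-12 : ℤ) 12),
      if v = 0 then (0 : ℝ) else ((Q v + (v.1 : ℝ) ^ 2 * x ^ 2)⁻¹) ^ n
  let T : ℝ → ℝ := fun x => (∑ k ∈ Finset.Icc (-((12 : ℕ) : ℤ)) ((12 : ℕ) : ℤ),
        (4608 : ℝ) / (5 * ((3 * ((12 : ℕ) : ℝ) - 2) ^ 2 + 12 * (k : ℝ) ^ 2 * x ^ 2) ^ 2)) +
        64 / (15 * ((12 : ℕ) : ℝ) ^ 3 * x ^ 4) + 18 / (5 * ((12 : ℕ) : ℝ) ^ 5 * x ^ 6)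
  have hQ : Q = fun v => (v.2.1 : ℝ) ^ 2 + (v.2.1 : ℝ) * v.2.2 + (v.2.2 : ℝ) ^ 2 +
      (if Even v.1 then 0 else ((v.2.1 : ℝ) + v.2.2 + 1 / 3)) := rfl
  have h1 := Summit.AtomisticToContinuum.Crystallization.Theorems.LjBilayerHcpSketch.stub_hcpPowerSums Q hQ
  have h2 := Summit.AtomisticToContinuum.Crystallization.Theorems.LjBilayerHcpSketch.stub_powerSums_antitone Q hQ
  have h5 : ∀ (t : ℝ), 0 < t →
      (∑' v : ℤ × ℤ × ℤ,
          if (|v.1| ≤ ((12 : ℕ) : ℤ) ∧ |v.2.1| ≤ ((12 : ℕ) : ℤ) ∧ |v.2.2| ≤ ((12 : ℕ) : ℤ)) then (0 : ℝ)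
          else if v = 0 then (0 : ℝ) else (((1 : ℝ) ^ 2 * Q v + (v.1 : ℝ) ^ 2 * t ^ 2)⁻¹) ^ 3) ≤ T t :=
    fun t ht => Summit.AtomisticToContinuum.Crystallization.Theorems.LjBilayerHcpSketch.stub_powerSum_tail
      Q hQ t 12 12 ht (by norm_num) (by norm_num)
  have hc := stub_certificate Q hQ Bx rfl T rfl
  exact Summit.AtomisticToContinuum.Crystallization.Theorems.LjBilayerHcpSketch.numeric_of_certificate
    Q hQ Bx rfl T h1 h2 h5 hc

/-- **The line concludes the crux BY NAME.**  The argmin of `e ∘ hcp` on the box (PROVED in the tree: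
`PricedHcpWindowsHcpBox.stub_hcpEnergyMinOnBox`) beats every box-hcp, which by Sν (`numeric_holds`) beats every
class-hcp, which by Sσ beats every `2/3`-separated normal period-2 stack; `ljBilayerHcp_of_normalForm` (p117119)
undoes the normal form.  No sorry of its own. -/
theorem LjBilayerHcp_of :
    Summit.AtomisticToContinuum.Crystallization.Theses.ChessboardParticlePlanes.LjBilayerHcp := by
  obtain ⟨a₀, h₀, ha₀, hh₀, b1, b2, b3, b4, hmin⟩ :=
    Summit.AtomisticToContinuum.Crystallization.Theorems.PricedHcpWindowsHcpBox.stub_hcpEnergyMinOnBox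
  refine Summit.AtomisticToContinuum.Crystallization.Theorems.LjBilayerHcpSketch.ljBilayerHcp_of_normalForm
    ⟨a₀, h₀, ha₀, hh₀, b1, b2, b3, b4, fun c hc B hsep h2c hL hpts => ?_⟩
  obtain ⟨a, h, ha, hh, ha23, hh34, hle⟩ := stub_structural c hc B hsep h2c hL hpts
  obtain ⟨a', h', ha', hh', c1, c2, c3, c4, hle'⟩ := numeric_holds a h ha hh ha23 hh34
  exact (hmin a' h' ha' hh' c1 c2 c3 c4).trans (hle'.trans hle)

end Summit.AtomisticToContinuum.Crystallization.Cruxes.LjBilayerHcp.Sketch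

end
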